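import Summits.NavierStokesRegularity.NavierStokesRegularity.Theorems.ScenarioCensusScrewBlowdownCone
import HarnessLib

/-!
# LINE «screw-blowdown» port, part 7/13: v1.5 `LinearConeLiouville` (S3-lin) and its bridges; v1.6 the residuals decided on the DSS stratum

Re-homed for the scenario census (typer seat ns-census-typer-1 g7; lead g9 RULINGS [7] 20:33Z / [8] 21:03Z / [12](b) 21:58Z: «screw-blowdown v1.8 =
version of record; `Row_A13isqT` DECIDED IN KERNEL → CANDIDATE-DECIDED member under A13 (row already TREE); typer-1 slot 3 port of record =
`ScrewBlowdown_port_v1_8.lean` bb5f719a8be448dd (stub-free)»; lead g10 RULINGS [1](b) 22:36Z / [2] 22:42Z: «port v1.9 ffe1ad3d1d25e376 = port of record (idea-crit-3 DIFF-CHECK 22:40:40Z CONFORMS); slot 4 = its S3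
appendix ADMISSIBLE after slot 3»; ref PRE-CHECKs items 13 / 15 / 20 / 27): VERBATIM PORT of ns-idea-4 LINE g12-1 «screw-blowdown» PORT copy
`pub/ideators/ns-idea-4/lines/screw-blowdown/port/ScrewBlowdown_port_v1_9.lean` sha16 ffe1ad3d1d25e376 (2890 l.; lean check rc 0, 0 sorry; = the v1.8
port copy bb5f719a8be448dd as a literal prefix — itself the v1.7 copy 674e939b7b0b34e8 + the `LocalPersistence` attack appendix `…LP` + the consequences
`localPersistence_holds` / `farPastSpreading_holds` / `linearConeLiouville_holds` / `row_A13isqT_proved` — plus the v1.9 S3 block: `vanishingBlowdownLiouville_holds`,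
`row_ArecT_proved`; parts 1–3 landed while v1.8 was the copy of record, text identical),
split for the 400-line rule into `ScenarioCensusScrewBlowdown` (§1–§3: objects, the cell `Row_A13isqT`, obligation Props, S1 PROVED) →
`…Plumbing` (§4, S2 PROVED) → `…Bridges` (§5 + v1.3) → `…Recurrent` (v1.4, `Row_ArecT`) → `…OffAxis` (v1.5 a) → `…Cone` (v1.5 b:
`farPast_linearCone_smallness_of_screw`) → `…Residual` (v1.5 c + v1.6: `LinearConeLiouville`, DSS rungs) → `…Propagation` (v1.7: FS, LP,
reductions; the three class-general tools are NOT re-declared — taken BY NAME, general `E`, from `Theorems/TypeIAncientMildForwardUniqueness.lean`,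
ns-idea-4 extract a1b589f6dec7da83, p671177) → `…LPTools` / `…LPDuhamel` / `…LP` (the appendix: Gaussian locality, the three-term Oseen split,
time weights; `duhamel_bound`; the bootstrap `one_step` / `persist` / `localPersistence` + the consequences incl. `row_A13isqT_proved`) →
`…Vanishing` (v1.9: S3 proved, `row_ArecT_proved`) → `…Keys` (census keys `Row_A13isqT` / `Row_ArecT` + `_excluded`).  Lean text VERBATIM in namespaces `…Theorems.ScenarioCensus.ScrewBlowdown` / `…ScrewBlowdownLP` (the line's
`…Lines.ScrewBlowdownPort` / `…PortLP` re-homed; qualified references renamed accordingly); port edits: `local notation "E3"` → `abbrev E3` (the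
appendix `open`s it), `@[conjecture]` on `VanishingBlowdownLiouville` only (part 1 landed while S3 was open; an obligation node, now with the closed
witness `vanishingBlowdownLiouville_holds`), seven one-line docstrings added, `continuous_rotZ_angle'` not re-declared (it restates the tree's
`Literature.Analysis.FluidPDE.continuous_rotZ_angle`, gate lint `dedup.landed`; its uses renamed), the line's `set_option linter.unusedVariables false` dropped (five proof lambdas
bind the unused `θ₀ h` as `_ _`; the unused hypothesis binders of `hasVanishingBlowdown_of_axiallyRecurrent` / `pointwise_small_of_zoom_small` are spelled `_hu` / `_hΛ`,
statements otherwise identical); `set_option maxHeartbeats … in` of the appendix kept as in the line.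

No census VALUE is moved by this file (row A13 is TREE already; the lead books the member A13isq-T); NS regularity is NOT proved; (L′)
`SymmetryModuliCount.TypeIAncientLiouville` is untouched (hypothesis of bridges only); no summit statement is proved by this file.
-/

-- the summit and its single problem share the name `NavierStokesRegularity` (D-0017 nested layout)
set_option linter.dupNamespace false

namespace Summit.NavierStokesRegularity.NavierStokesRegularity.Theorems.ScenarioCensus.ScrewBlowdown

open Set Function Filter Topology
open Literature.Analysis Literature.Analysis.FluidPDE
open Summit.NavierStokesRegularity.NavierStokesRegularity.Theorems

/-- S3-lin · LINEAR-CONE LIOUVILLE (the WEAKER research residual after v1.5, NO symmetry; implied by S3, see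
`linearConeLiouville_of_vanishingBlowdownLiouville`): a Type-I ancient mild field with `√(−t) u → 0` uniformly on
every linear cone `|x_h| ≤ K(−t)` about the axis, as `t → −∞`, is identically zero. -/
def LinearConeLiouville : Prop :=
  ∀ (C : ℝ) (u : ℝ → E3 → E3), IsTypeIAncientMild C u →
    (∀ ε > (0 : ℝ), ∀ K > (0 : ℝ), ∃ T < (0 : ℝ), ∀ t < T, ∀ x : E3,
      x 0 ^ 2 + x 1 ^ 2 ≤ K ^ 2 * t ^ 2 → Real.sqrt (-t) * ‖u t x‖ ≤ ε) →
    ∀ t < (0 : ℝ), ∀ x, u t x = 0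

/-- The screw row reduces to the WEAKER residual S3-lin (v1.5). -/
theorem row_A13isqT_of_linearConeLiouville (h3 : LinearConeLiouville) : Row_A13isqT :=
  fun C u _ _ hu hθ hh hS => h3 C u hu (farPast_linearCone_smallness_of_screw hu hθ hh hS)

/-- Cone smallness forces every (on-axis) blow-down limit to vanish. -/
theorem hasVanishingBlowdown_of_coneSmall {C : ℝ} {u : ℝ → E3 → E3}
    (hsmall : ∀ ε > (0 : ℝ), ∀ K > (0 : ℝ), ∃ T < (0 : ℝ), ∀ t < T, ∀ x : E3,
      x 0 ^ 2 + x 1 ^ 2 ≤ K ^ 2 * t ^ 2 → Real.sqrt (-t) * ‖u t x‖ ≤ ε) :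
    HasVanishingBlowdown C u := by
  intro W hW s hs y
  obtain ⟨hWc, μ, hμ, hμlim, hconv⟩ := hW
  have hL : Tendsto (fun k => nsRescale (μ k) u s y) atTop (𝓝 (W s y)) :=
    (hconv s hs).tendsto_comp (hWc.continuous_slice hs).continuousAt tendsto_const_nhds
  -- the zooms at (s, y) are eventually ε/√(−s)-small for every ε
  have hsmallk : ∀ ε > (0 : ℝ), ∀ᶠ k in atTop, ‖nsRescale (μ k) u s y‖ ≤ ε / Real.sqrt (-s) := by
    intro ε hε
    have hs' : 0 < -s := by linarith
    obtain ⟨K, hK⟩ : ∃ K : ℝ, K = Real.sqrt (y 0 ^ 2 + y 1 ^ 2) / (-s) + 1 := ⟨_, rfl⟩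
    have hKpos : 0 < K := by rw [hK]; positivity
    have hyK : y 0 ^ 2 + y 1 ^ 2 ≤ K ^ 2 * s ^ 2 := by
      have h1 : Real.sqrt (y 0 ^ 2 + y 1 ^ 2) ≤ K * (-s) := by
        rw [hK, add_mul, div_mul_cancel₀ _ hs'.ne']
        linarith
      have h2 := pow_le_pow_left₀ (Real.sqrt_nonneg _) h1 2
      rw [Real.sq_sqrt (by positivity)] at h2
      calc y 0 ^ 2 + y 1 ^ 2 ≤ (K * -s) ^ 2 := h2
        _ = K ^ 2 * s ^ 2 := by ring
    obtain ⟨T, hT, hT'⟩ := hsmall ε hε K hKpos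
    have hev1 : ∀ᶠ k in atTop, 1 ≤ μ k := hμlim.eventually_ge_atTop 1
    have hev2 : ∀ᶠ k in atTop, μ k ^ 2 * s < T := by
      have : Tendsto (fun k => μ k ^ 2 * (-s)) atTop atTop :=
        (tendsto_pow_atTop two_ne_zero |>.comp hμlim).atTop_mul_const hs'
      have h2 := this.eventually_gt_atTop (-T)
      exact h2.mono fun k hk => by linarith
    filter_upwards [hev1, hev2] with k hk1 hk2
    have hμk : 0 < μ k := hμ k
    have hts : μ k ^ 2 * s < 0 := mul_neg_of_pos_of_neg (by positivity) hs
    have hpt : (μ k • y) 0 ^ 2 + (μ k • y) 1 ^ 2 ≤ K ^ 2 * (μ k ^ 2 * s) ^ 2 := by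
      simp only [PiLp.smul_apply, smul_eq_mul]
      have hμ2 : μ k ^ 2 ≤ μ k ^ 2 * μ k ^ 2 := by nlinarith [one_le_pow₀ (n := 2) hk1]
      calc (μ k * y 0) ^ 2 + (μ k * y 1) ^ 2 = μ k ^ 2 * (y 0 ^ 2 + y 1 ^ 2) := by ring
        _ ≤ μ k ^ 2 * (K ^ 2 * s ^ 2) := mul_le_mul_of_nonneg_left hyK (sq_nonneg _)
        _ ≤ (μ k ^ 2 * μ k ^ 2) * (K ^ 2 * s ^ 2) := mul_le_mul_of_nonneg_right hμ2 (by positivity)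
        _ = K ^ 2 * (μ k ^ 2 * s) ^ 2 := by ring
    have hb := hT' (μ k ^ 2 * s) hk2 (μ k • y) hpt
    have hsq : Real.sqrt (-(μ k ^ 2 * s)) = μ k * Real.sqrt (-s) := by
      rw [show -(μ k ^ 2 * s) = μ k ^ 2 * (-s) by ring, Real.sqrt_mul (sq_nonneg _), Real.sqrt_sq hμk.le]
    rw [hsq] at hb
    have hsr : 0 < Real.sqrt (-s) := Real.sqrt_pos.2 hs'
    rw [le_div_iff₀ hsr]
    calc ‖nsRescale (μ k) u s y‖ * Real.sqrt (-s) = μ k * Real.sqrt (-s) * ‖u (μ k ^ 2 * s) (μ k • y)‖ := by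
          simp only [nsRescale, norm_smul, Real.norm_eq_abs, abs_of_pos hμk]; ring
      _ ≤ ε := hb
  -- hence the limit has norm ≤ ε/√(−s) for every ε
  have hle : ∀ ε > (0 : ℝ), ‖W s y‖ ≤ ε / Real.sqrt (-s) := fun ε hε =>
    le_of_tendsto hL.norm (hsmallk ε hε)
  by_contra hne
  have hpos : 0 < ‖W s y‖ := norm_pos_iff.2 hne
  have hsr : 0 < Real.sqrt (-s) := Real.sqrt_pos.2 (by linarith)
  have := hle (‖W s y‖ * Real.sqrt (-s) / 2) (by positivity)
  rw [le_div_iff₀ hsr] at this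
  nlinarith

/-- The residuals are ordered: S3 ⇒ S3-lin (so v1.5 WEAKENS what is left). -/
theorem linearConeLiouville_of_vanishingBlowdownLiouville (h3 : VanishingBlowdownLiouville) :
    LinearConeLiouville :=
  fun C u hu hsmall => h3 C u hu (hasVanishingBlowdown_of_coneSmall hsmall)

/-- BRIDGE BY NAME: (L′) ⇒ S3-lin. -/
theorem linearConeLiouville_of_typeIAncientLiouville
    (hL : Summit.NavierStokesRegularity.NavierStokesRegularity.Theses.SymmetryModuliCount.TypeIAncientLiouville) :
    LinearConeLiouville :=
  fun C u hu _ => hL C u (isTypeIAncientMild_iff.1 hu)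

/-! ### v1.6 — the residuals DECIDED on the DSS stratum (BC5 rungs; PROVED; additive)

On discretely self-similar fields (`IsDiscretelySelfSimilar c u : nsRescale c u = u`, `1 < c`) both residuals hold
outright: a DSS field is a blow-down limit of ITSELF (along `μ_k = c^k`), so `HasVanishingBlowdown` forces `u ≡ 0`
(S3 on DSS), and cone smallness in the far past transports to every `(t, x)` by the exact scaling symmetry (S3-lin on
DSS).  Meanwhile (L′) restricted to the DSS stratum — «every DSS KNSS-gauge Type-I ancient mild field vanishes», i.e.
the exclusion of DSS singularity profiles — is OPEN.  HONEST: the rungs are cheap because on DSS fields the residual's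
hypothesis already contains the conclusion; they certify that S3 / S3-lin are not the DSS problem in costume (their
hypotheses are violated by every non-zero DSS candidate), not that S3 is within reach. -/

/-- Powers of a DSS factor are DSS factors (inline; the tree's `BradshawTsai2019.isDiscretelySelfSimilar_pow` lives in a
module not imported here). -/
theorem isDiscretelySelfSimilar_pow' {c : ℝ} {u : ℝ → E3 → E3} (h : IsDiscretelySelfSimilar c u) (m : ℕ) :
    IsDiscretelySelfSimilar (c ^ m) u := by
  induction m with
  | zero => rw [pow_zero]; exact nsRescale_one u
  | succ m ih =>
    unfold IsDiscretelySelfSimilar at h ih ⊢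
    rw [pow_succ, nsRescale_mul, ih, h]

/-- A constant sequence converges locally uniformly. -/
theorem tendstoLocallyUniformly_const' (f : E3 → E3) : TendstoLocallyUniformly (fun _ : ℕ => f) f atTop := by
  rw [Metric.tendstoLocallyUniformly_iff]
  intro ε hε x
  exact ⟨Set.univ, Filter.univ_mem, Eventually.of_forall fun n y _ => by rw [dist_self]; exact hε⟩

/-- A DSS field of the class is a blow-down limit of itself (scales `c^k`). -/
theorem isBlowdownLimit_self_of_dss {C c : ℝ} {u : ℝ → E3 → E3} (hu : IsTypeIAncientMild C u) (hc : 1 < c)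
    (hdss : IsDiscretelySelfSimilar c u) : IsBlowdownLimit C u u := by
  have e : ∀ k : ℕ, nsRescale (c ^ k) u = u := fun k => isDiscretelySelfSimilar_pow' hdss k
  refine ⟨hu, fun k => c ^ k, fun k => pow_pos (by linarith) k, tendsto_pow_atTop_atTop_of_one_lt hc,
    fun t ht => ?_⟩
  simp only [e]
  exact tendstoLocallyUniformly_const' (u t)

/-- **S3 holds on the DSS stratum** (BC5 rung for `VanishingBlowdownLiouville`; (L′) on DSS fields is OPEN). -/
theorem vanishingBlowdownLiouville_on_dss {C c : ℝ} {u : ℝ → E3 → E3} (hu : IsTypeIAncientMild C u)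
    (hc : 1 < c) (hdss : IsDiscretelySelfSimilar c u) (hV : HasVanishingBlowdown C u) :
    ∀ t < (0 : ℝ), ∀ x, u t x = 0 :=
  hV u (isBlowdownLimit_self_of_dss hu hc hdss)

/-- **S3-lin holds on the DSS stratum** (BC5 rung for `LinearConeLiouville`; no class hypothesis is even needed). -/
theorem linearConeLiouville_on_dss {c : ℝ} {u : ℝ → E3 → E3} (hc : 1 < c) (hdss : IsDiscretelySelfSimilar c u)
    (hsmall : ∀ ε > (0 : ℝ), ∀ K > (0 : ℝ), ∃ T < (0 : ℝ), ∀ t < T, ∀ x : E3,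
      x 0 ^ 2 + x 1 ^ 2 ≤ K ^ 2 * t ^ 2 → Real.sqrt (-t) * ‖u t x‖ ≤ ε) :
    ∀ t < (0 : ℝ), ∀ x, u t x = 0 := by
  intro t ht x
  by_contra hne
  have hst : 0 < Real.sqrt (-t) := Real.sqrt_pos.2 (by linarith)
  have hpos : 0 < Real.sqrt (-t) * ‖u t x‖ := mul_pos hst (norm_pos_iff.2 hne)
  obtain ⟨T, hT, hT'⟩ := hsmall (Real.sqrt (-t) * ‖u t x‖ / 2) (by positivity) 1 one_pos
  have hlim : Tendsto (fun k : ℕ => c ^ k) atTop atTop := tendsto_pow_atTop_atTop_of_one_lt hc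
  have hlim2 : Tendsto (fun k : ℕ => (c ^ k) ^ 2) atTop atTop := (tendsto_pow_atTop two_ne_zero).comp hlim
  have hev1 : ∀ᶠ k : ℕ in atTop, (c ^ k) ^ 2 * t < T := by
    have h2 : Tendsto (fun k : ℕ => (c ^ k) ^ 2 * (-t)) atTop atTop := hlim2.atTop_mul_const (by linarith)
    exact (h2.eventually_gt_atTop (-T)).mono fun k hk => by linarith
  have hev2 : ∀ᶠ k : ℕ in atTop, x 0 ^ 2 + x 1 ^ 2 ≤ (c ^ k) ^ 2 * t ^ 2 := by
    have ht2 : 0 < t ^ 2 := by have := sq_pos_of_neg ht; simpa using this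
    have h2 : Tendsto (fun k : ℕ => (c ^ k) ^ 2 * t ^ 2) atTop atTop := hlim2.atTop_mul_const ht2
    exact h2.eventually_ge_atTop _
  obtain ⟨k, hk1, hk2⟩ := (hev1.and hev2).exists
  have hck : 0 < c ^ k := pow_pos (by linarith) k
  have e : nsRescale (c ^ k) u = u := isDiscretelySelfSimilar_pow' hdss k
  have eval : u t x = c ^ k • u ((c ^ k) ^ 2 * t) (c ^ k • x) := by
    have h0 := congrFun (congrFun e t) x
    simp only [nsRescale] at h0
    exact h0.symm
  have hcone : (c ^ k • x) 0 ^ 2 + (c ^ k • x) 1 ^ 2 ≤ (1 : ℝ) ^ 2 * ((c ^ k) ^ 2 * t) ^ 2 := by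
    simp only [PiLp.smul_apply, smul_eq_mul]
    calc (c ^ k * x 0) ^ 2 + (c ^ k * x 1) ^ 2 = (c ^ k) ^ 2 * (x 0 ^ 2 + x 1 ^ 2) := by ring
      _ ≤ (c ^ k) ^ 2 * ((c ^ k) ^ 2 * t ^ 2) := mul_le_mul_of_nonneg_left hk2 (sq_nonneg _)
      _ = (1 : ℝ) ^ 2 * ((c ^ k) ^ 2 * t) ^ 2 := by ring
  have hb := hT' ((c ^ k) ^ 2 * t) hk1 (c ^ k • x) hcone
  have hsq : Real.sqrt (-((c ^ k) ^ 2 * t)) = c ^ k * Real.sqrt (-t) := by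
    rw [show -((c ^ k) ^ 2 * t) = (c ^ k) ^ 2 * (-t) by ring, Real.sqrt_mul (sq_nonneg _),
      Real.sqrt_sq hck.le]
  rw [hsq] at hb
  have hnorm : ‖u t x‖ = c ^ k * ‖u ((c ^ k) ^ 2 * t) (c ^ k • x)‖ := by
    rw [eval, norm_smul, Real.norm_eq_abs, abs_of_pos hck]
  have hle : Real.sqrt (-t) * ‖u t x‖ ≤ Real.sqrt (-t) * ‖u t x‖ / 2 :=
    calc Real.sqrt (-t) * ‖u t x‖ = c ^ k * Real.sqrt (-t) * ‖u ((c ^ k) ^ 2 * t) (c ^ k • x)‖ := by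
          rw [hnorm]; ring
      _ ≤ Real.sqrt (-t) * ‖u t x‖ / 2 := hb
  linarith

end Summit.NavierStokesRegularity.NavierStokesRegularity.Theorems.ScenarioCensus.ScrewBlowdown
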